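import Mathlib
import Literature.NumberTheory.Irrationality.BrownZudilin2022.GeneralFamily
import Literature.NumberTheory.Irrationality.Zudilin2002.WellPoisedIntegrals
import Literature.NumberTheory.Transcendental.PeriodsWave0
import HarnessLib

/-!
# Brown–Zudilin 2022, Sect. 6: the descent of `I″(a)` to generalised Beukers integrals (eq. (22)–(24))

Topic `Literature/NumberTheory/Irrationality/BrownZudilin2022`. Typed, cited statement (ONE named fact, no proof) with the
definitions it needs, read on the page from F. Brown, W. Zudilin, *On cellular rational approximations to ζ(5)*,
arXiv:2210.03391 [BrownZudilin2022], Sect. 6 "Descent to ζ(3)" (arXiv text pp. 13–15): the displayed formula (22)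
"`I″(a) = (−1)^{p₄+p₅+p₆} Σ_{k∈ℤ} (−1)^k C(k,p₆) C(q₄,k−p₄) C(q₅,k−p₅) · J₃(p₀,p₁,p₂,p₃−k; q₁,q₂,q₃−p₆+k)`", where (23)
"`J₃(p₀,p₁,p₂,p₃;q₁,q₂,q₃) = ∫∫∫_{[0,1]³} y₁^{p₁}(1−y₁)^{q₁} y₂^{p₂}(1−y₂)^{q₂} y₃^{p₃}(1−y₃)^{q₃} dy₁dy₂dy₃ / (1−y₃(1−y₁y₂))^{p₀+1}`
is the generalised Beukers integral [4]", "(24) `p₃+q₃ = q₁+q₂` … implies that `J₃ = 2Aζ(3) − B`; furthermore, by the results in [27]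
we have `A = (−1)^{p₀+p₁+p₂+p₃} Σ_{k∈ℤ} C(k,p₀) C(k+q₃−p₀, p₃+q₃−p₀) C(q₁,k−p₁) C(q₂,k−p₂)`, which combined with (22) leads to another
proof of formula (17)."  Here `I(a) = Q(a)(2ζ(5)+4ζ(3)ζ(2)) − 4P̂(a)ζ(2) − 2P(a)` is the decomposition (4) of the cellular integral (1)
(`cellularIntegral`), `I′(a) = Q(a)ζ(5) − P(a)`, `I″(a) = Q(a)ζ(3) − P̂(a)` (Sect. 1), so that `I(a) = 2I′(a) + 4ζ(2)I″(a)`, and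
`(p;q) = (p(a);q(a))` are the twelve parameters (11) (`pOf`, `qOf`).  HONEST FRAMING (cell pub-zeta5): systematic search; no
irrationality claim unless certified — (22) is an identity between real integrals; nothing here is an arithmetic claim.

## How (22) is typed (read this before using `descent22`)
* **As an identity of real numbers.**  `P̂(a)`, `P(a)` are not objects of the tree (the source defines them only as THE coefficients
  produced by its decomposition algorithm, Remark 1; the tree's `GeneralFamily.decomposition` is existential).  Eliminating them,
  (4) ∧ (22) say: `∃ P ∈ ℚ, I(a) = 2(Q(a)ζ(5) − P) + 4ζ(2)·I″(a)` with `I″(a)` the right-hand side of (22).  This is `descent22`.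
* **Normalisation (factor ½).**  With `J₃` the integral (23) and `J₃ = 2Aζ(3) − B` as printed, the ζ(3)-coefficient of the
  right-hand side of (22) is `2·Σ_k w_k A_k`, while the source's own composition "(22) combined with [the formula for A] leads to
  another proof of (17)" is the TERMWISE identity `Σ_k w_k(p;q)·A(p₀,p₁,p₂,p₃−k;q₁,q₂,q₃−p₆+k) = Q(p;q)` (compare (17): its inner
  `k₂`-sum carries exactly the weights `w_k` of (22); `Qcoeff`) — i.e. `Q(a)`, not `2Q(a)`.  Consistently, on the source's first
  example (Sect. 2, `a = (1,…,1)`: `Q₁ = 21`, `P̂₁ = 101/4`, `I″ = 21ζ(3) − 101/4`) the right-hand side of (22) evaluates to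
  `42ζ(3) − 101/2 = 2I″(a)` (cell pub-zeta5, exact evaluation of the two `J₃`'s, gen-1; and 38-digit numerics of (15), gen-1 g2).
  We therefore type (22) in the only normalisation consistent with (4), (17) and Sect. 2 of the source:
  `I″(a) = ½ · (−1)^{p₄+p₅+p₆} Σ_k (−1)^k C(k,p₆)C(q₄,k−p₄)C(q₅,k−p₅) J₃(…)`, i.e. `I(a) = 2(Q(a)ζ(5) − P) + 2ζ(2)·Σ_k w_k J₃(…)`.
  (The display (22) omits this `½`; the typed statement says so in its name-free form.  This is a READING of a misprinted constant,
  recorded here and in the cell's DICTIONARY.md §3 E2 / `code/gen1/cellular.py` ("(22) evaluates to 2I″(a)"), not a new claim.)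
* **Range.**  The source states (22) for all admissible `a`; its derivation expands `(1−y₃(1−y₄y₅))^{−p₆−1}` in powers of
  `(1−y₃)/(y₃y₄y₅)` and takes the residue at `|y₄| = |y₅| = ε`.  The cell found (gen-1 g2, DICTIONARY.md §4: 1996/1996 exact box points
  for, 1400/1401 against) that the displayed finite sum equals `I″(a)` exactly when `p₄ + q₄ ≤ p₃` (then every companion integral
  `J₃(…, p₃−k; …)` in the binomial support `p₄ ≤ k ≤ p₄+q₄` has `p₃ − k ≥ 0` and converges), and that for `p₄+q₄ > p₃` regularised boundary
  terms are missing.  We type (22) ONLY on `p₄ + q₄ ≤ p₃` ("the residue range"), with the non-negativity of the twelve parameters and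
  the convergence of each `J₃` term as explicit provisos — a restriction of the printed claim to where its printed derivation applies.
* `J₃` is typed through the tree's Sorokin-type integral `Zudilin2002.sorokinIntegral` (math/0206177 (2)–(3)):
  `1 − y₃(1 − y₁y₂) = Q₃(y₃, y₁, 1−y₂)` with `Q₃(x₁,x₂,x₃) = 1 − x₁(1 − x₂(1 − x₃))`, so (23) is
  `J_3(p₀+1; p₃+1, p₁+1, q₂+1 | p₃+q₃+2, p₁+q₁+2, p₂+q₂+2)` after the measure-preserving substitution `(x₁,x₂,x₃) = (y₃,y₁,1−y₂)` of
  `[0,1]³`.  TODO(fidelity): the verbatim (23) (variables `y`, integer powers) is not typed separately; the substitution is the only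
  difference.

## Contents
* `J3` — (23) (via `sorokinIntegral 3`); `w22` — the weights `(−1)^{p₄+p₅+p₆+k} C(k,p₆)C(q₄,k−p₄)C(q₅,k−p₅)` of (22); `rhs22` — the finite
  sum of (22) over its binomial support `p₄ ≤ k ≤ p₄+q₄`; `Acoeff` — the ζ(3)-coefficient `A` of `J₃` (display after (24), from [27]);
  `J3TermsConverge` — the provisos; PROVED `Qcoeff_eq_sum_w22_Acoeff` (`Q = Σ_k w_k A_k`, the source's "another proof of (17)");
  NAMED FACT `descent22`.
* Index conventions as in `GeneralFamily`: `p : Fin 7 → ℤ` is `(p₀,…,p₆)`, `q : Fin 5 → ℤ` has entry `j` equal to `q_{j+1}`.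
Not typed here: the mirror variant (residue at `|y₁| = |y₂| = ε`), the boundary-corrected form outside the residue range (internally
minted by the cell, never citable), `J₃ = 2Aζ(3) − B` itself ([17] = Rhin–Viola; the tree has the stronger `Zudilin2002.vwp_eq_integral_of_pos`).
-/

noncomputable section

open Finset

namespace Literature.NumberTheory.Irrationality.BrownZudilin2022

open Literature.NumberTheory.Transcendental (zetaValue)

/-- **The generalised Beukers integral (23)**
`J₃(p₀,p₁,p₂,p₃;q₁,q₂,q₃) = ∫_{[0,1]³} y₁^{p₁}(1−y₁)^{q₁}y₂^{p₂}(1−y₂)^{q₂}y₃^{p₃}(1−y₃)^{q₃} / (1−y₃(1−y₁y₂))^{p₀+1} dy`,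
typed as Zudilin's `J_3(p₀+1; p₃+1, p₁+1, q₂+1 | p₃+q₃+2, p₁+q₁+2, p₂+q₂+2)` (`Zudilin2002.sorokinIntegral 3`; the substitution
`(x₁,x₂,x₃) = (y₃,y₁,1−y₂)`, module docstring).  A real number (Bochner integral; junk `0` if divergent).
[cite: BrownZudilin2022, Sect. 6, eq. (23)] -/
def J3 (p₀ p₁ p₂ p₃ q₁ q₂ q₃ : ℤ) : ℝ :=
  Zudilin2002.sorokinIntegral 3 ((p₀ : ℝ) + 1)
    (fun i => if i = 0 then (p₃ : ℝ) + 1 else if i = 1 then (p₁ : ℝ) + 1 else (q₂ : ℝ) + 1)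
    (fun i => if i = 0 then (p₃ : ℝ) + q₃ + 2 else if i = 1 then (p₁ : ℝ) + q₁ + 2 else (p₂ : ℝ) + q₂ + 2)

/-- The weight of the `k`-th term of (22): `(−1)^{p₄+p₅+p₆+k} C(k,p₆) C(q₄,k−p₄) C(q₅,k−p₅)` (binomials `zchoose`, zero outside
`0 ≤ lower ≤ upper`; the sign is read through `Int.toNat`, all four summands being non-negative on the support).
[cite: BrownZudilin2022, Sect. 6, eq. (22)] -/
def w22 (p : Fin 7 → ℤ) (q : Fin 5 → ℤ) (k : ℤ) : ℤ :=
  (-1) ^ (p 4 + p 5 + p 6 + k).toNat * zchoose k (p 6) * zchoose (q 3) (k - p 4) * zchoose (q 4) (k - p 5)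

/-- The right-hand side of (22) as displayed (WITHOUT the factor `½` of the module docstring):
`Σ_k (−1)^{p₄+p₅+p₆+k} C(k,p₆)C(q₄,k−p₄)C(q₅,k−p₅) · J₃(p₀,p₁,p₂,p₃−k; q₁,q₂,q₃−p₆+k)`, the sum over the binomial support
`p₄ ≤ k ≤ p₄+q₄` (outside it `C(q₄,k−p₄) = 0`).  [cite: BrownZudilin2022, Sect. 6, eq. (22)] -/
def rhs22 (p : Fin 7 → ℤ) (q : Fin 5 → ℤ) : ℝ :=
  ∑ k ∈ Icc (p 4) (p 4 + q 3), (w22 p q k : ℝ) * J3 (p 0) (p 1) (p 2) (p 3 - k) (q 0) (q 1) (q 2 - p 6 + k)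

/-- The ζ(3)-coefficient `A` of `J₃ = 2Aζ(3) − B` under (24) `p₃+q₃ = q₁+q₂`:
`A(p₀,p₁,p₂,p₃;q₁,q₂,q₃) = (−1)^{p₀+p₁+p₂+p₃} Σ_k C(k,p₀) C(k+q₃−p₀, p₃+q₃−p₀) C(q₁,k−p₁) C(q₂,k−p₂)` (support `p₁ ≤ k ≤ p₁+q₁`).
[cite: BrownZudilin2022, Sect. 6, display after eq. (24) (from [27] = Zudilin 2004)] -/
def Acoeff (p₀ p₁ p₂ p₃ q₁ q₂ q₃ : ℤ) : ℤ :=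
  (-1) ^ (p₀ + p₁ + p₂ + p₃).toNat *
    ∑ k ∈ Icc p₁ (p₁ + q₁), zchoose k p₀ * zchoose (k + q₃ - p₀) (p₃ + q₃ - p₀) * zchoose q₁ (k - p₁) * zchoose q₂ (k - p₂)

/-- **"(22) combined with [the formula for `A`] leads to another proof of formula (17)" — PROVED as the finite identity
`Q(p;q) = Σ_k w_k(p;q) · A(p₀,p₁,p₂,p₃−k; q₁,q₂,q₃−p₆+k)`** (for `p ≥ 0` and `p₄+q₄ ≤ p₃`, so that all sign exponents are
non-negative): the `k₁`-sum of (17) is exactly the sum defining `A` at the `k`-th companion parameters, and the signs multiply to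
`(−1)^{p₀+⋯+p₆}`.  This is the bookkeeping behind the normalisation of `descent22` (module docstring: the ζ(3)-coefficient of
`Σ_k w_k J₃(…)` is `2Q`, not `Q`).  [cite: BrownZudilin2022, Sect. 6, sentence after eq. (24)] -/
theorem Qcoeff_eq_sum_w22_Acoeff (p : Fin 7 → ℤ) (q : Fin 5 → ℤ) (hp : ∀ i, 0 ≤ p i) (hres : p 4 + q 3 ≤ p 3) :
    Qcoeff p q = ∑ k ∈ Icc (p 4) (p 4 + q 3), w22 p q k * Acoeff (p 0) (p 1) (p 2) (p 3 - k) (q 0) (q 1) (q 2 - p 6 + k) := by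
  unfold Qcoeff Acoeff w22
  rw [Finset.sum_comm, Finset.mul_sum]
  refine Finset.sum_congr rfl fun k₂ hk₂ => ?_
  have hk := Finset.mem_Icc.1 hk₂
  have h0 := hp 0; have h1 := hp 1; have h2 := hp 2; have h4 := hp 4; have h5 := hp 5; have h6 := hp 6
  have hs : ((-1 : ℤ) ^ (∑ i, p i).toNat) =
      (-1) ^ (p 4 + p 5 + p 6 + k₂).toNat * (-1) ^ (p 0 + p 1 + p 2 + (p 3 - k₂)).toNat := by
    rw [← pow_add, Fin.sum_univ_seven]
    rw [show (p 4 + p 5 + p 6 + k₂).toNat + (p 0 + p 1 + p 2 + (p 3 - k₂)).toNat =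
      (p 0 + p 1 + p 2 + p 3 + p 4 + p 5 + p 6).toNat by omega]
  simp only [Finset.mul_sum]
  refine Finset.sum_congr rfl fun k₁ _ => ?_
  rw [hs, show k₁ + (q 2 - p 6 + k₂) - p 0 = k₁ + k₂ + q 2 - p 0 - p 6 by ring,
    show p 3 - k₂ + (q 2 - p 6 + k₂) - p 0 = p 3 + q 2 - p 0 - p 6 by ring]
  ring

/-- The provisos under which every companion integral of (22) with non-zero weight is a CONVERGENT `J₃`: for `p₄ ≤ k ≤ p₄+q₄` with
`p₆ ≤ k`, the seven parameters `(p₀,p₁,p₂,p₃−k; q₁,q₂,q₃−p₆+k)` are `≥ 0` and `p₀ ≤ p₁ + (q₃−p₆+k)`, `p₀ ≤ p₂ + (q₃−p₆+k)` (the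
integrability conditions of (23) at the corner `y₃ = 1`, `y₁y₂ = 0`).  Decidable linear conditions.
[cite: BrownZudilin2022, Sect. 6, eq. (22)–(23)] -/
def J3TermsConverge (p : Fin 7 → ℤ) (q : Fin 5 → ℤ) : Prop :=
  ∀ k ∈ Icc (p 4) (p 4 + q 3), p 6 ≤ k →
    0 ≤ p 3 - k ∧ 0 ≤ q 2 - p 6 + k ∧ p 0 ≤ p 1 + (q 2 - p 6 + k) ∧ p 0 ≤ p 2 + (q 2 - p 6 + k)

/-- The provisos are decidable (finitely many linear integer conditions). [cite: BrownZudilin2022, Sect. 6, eq. (22)–(23)] -/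
instance (p : Fin 7 → ℤ) (q : Fin 5 → ℤ) : Decidable (J3TermsConverge p q) := by
  unfold J3TermsConverge; infer_instance

/-- **Brown–Zudilin (22), typed as an identity of real numbers in the residue range (named fact, statement only).**
For `a` with `I(a)` convergent, the twelve parameters `(p;q) = (p(a);q(a))` non-negative, `p₄ + q₄ ≤ p₃` (the residue range) and the
provisos `J3TermsConverge`: there is a rational `P` (the source's `P(a)`) with
`I(a) = 2(Q(a)ζ(5) − P) + 2ζ(2) · Σ_k (−1)^{p₄+p₅+p₆+k} C(k,p₆)C(q₄,k−p₄)C(q₅,k−p₅) J₃(p₀,p₁,p₂,p₃−k; q₁,q₂,q₃−p₆+k)` —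
i.e. (4) with `I″(a) = Q(a)ζ(3) − P̂(a)` equal to ONE HALF of the displayed right-hand side of (22) (normalisation: module docstring;
the display omits the `½`).  Restricted to the residue range, where the source's residue computation applies term by term (module
docstring).  Status in the tree: the conclusion is PROVED on the wedge dictionary's box —
`Summits/KontsevichZagierPeriods/Zeta5Search/VWPOfPosConsequences.lean` `bz22_on_box` (p538491; not restated here because Literature
cannot import Summits); no printed proof of the full range typed here is known to the cell (the source derives (22) from a display
asserted from its decomposition computation), so this remains a named fact.
[cite: BrownZudilin2022, Sect. 6, eq. (22) with (23), and Sect. 1, eq. (4); normalisation fixed by Sect. 2 (Q₁ = 21, P̂₁ = 101/4) and Sect. 5, eq. (17)] -/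
def descent22 : Prop :=
  ∀ a : Fin 8 → ℤ, Converges a → (∀ i, 0 ≤ pOf a i) → (∀ i, 0 ≤ qOf a i) →
    pOf a 4 + qOf a 3 ≤ pOf a 3 → J3TermsConverge (pOf a) (qOf a) →
    ∃ P : ℚ, cellularIntegral a =
      2 * ((QOf a : ℝ) * zetaValue 5 - (P : ℝ)) + 2 * zetaValue 2 * rhs22 (pOf a) (qOf a)

/-! ### Sanity checks (not citable): the weights and the support at the source's first example `a = (1,…,1)`
(`p = (1,1,1,2,1,1,1)`, `q = (1,1,1,1,1)`; two terms `k = 1, 2`; `Σ_k w_k A_k = 1·5 + (−2)·(−8) = 21 = Q₁`). -/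

example : pOf (fun _ => 1) = ![1, 1, 1, 2, 1, 1, 1] ∧ qOf (fun _ => 1) = ![1, 1, 1, 1, 1] := by decide

example : w22 ![1, 1, 1, 2, 1, 1, 1] ![1, 1, 1, 1, 1] 1 = 1 ∧ w22 ![1, 1, 1, 2, 1, 1, 1] ![1, 1, 1, 1, 1] 2 = -2 := by decide

example : Acoeff 1 1 1 1 1 1 1 = 5 ∧ Acoeff 1 1 1 0 1 1 2 = -8 := by decide

example : (∑ k ∈ Icc (1 : ℤ) 2, w22 ![1, 1, 1, 2, 1, 1, 1] ![1, 1, 1, 1, 1] k * Acoeff 1 1 1 (2 - k) 1 1 (1 - 1 + k)) = 21 ∧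
    QOf (fun _ => 1) = 21 := by decide

example : J3TermsConverge ![1, 1, 1, 2, 1, 1, 1] ![1, 1, 1, 1, 1] := by decide

example : Qcoeff ![1, 1, 1, 2, 1, 1, 1] ![1, 1, 1, 1, 1] =
    ∑ k ∈ Icc (1 : ℤ) (1 + 1), w22 ![1, 1, 1, 2, 1, 1, 1] ![1, 1, 1, 1, 1] k * Acoeff 1 1 1 (2 - k) 1 1 (1 - 1 + k) :=
  Qcoeff_eq_sum_w22_Acoeff _ _ (by decide) (by decide)

end Literature.NumberTheory.Irrationality.BrownZudilin2022
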